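import Literature.Geometry.Kaehler.ComplexTorusAntisymplecticGraphQuotient
import Literature.Geometry.Kaehler.ComplexTorusPolarizedIsoProduct
import Literature.NumberTheory.ComplexMultiplication.CMTorusEquivariantIsogenies
import HarnessLib

/-!
# Debarre's construction `(Y × Z)/graph(p)` is functorial in the data `(Y, θ_Y, Z, θ_Z, p)`
# (Iribar López 2024, Lemma 10 / Def. 4; Auffarth 2016, §3 Thm. 3.5 — the equivariance half)

Layer `Literature/Geometry/Kaehler`, namespace `Literature.Geometry.Kaehler.ComplexTorus`; lane `lit-hodgefound`
(Track 2 foundations library, Layer A4, row A4-77, seat `lit-hodgefound-skel-4`, FILE H of the row).  Sequel of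
`ComplexTorusAntisymplecticGraphQuotient.lean` (row A4-76 FILE A: `graphSubgroup`, `IsAntisymplectic`,
`isPrincipalPolarization_quotientBy_graphSubgroup` — Debarre's principally polarised torus `(Y × Z)/graph(p)`),
of `SiegelLevelModuli.lean` §3 (`IsPolarizedIso`, `IsPolarizedIso.exists_matrix`, `exists_isPolarizedIso_of_matrix`),
`ComplexTorusPolarizedIsoProduct.lean` (`IsPolarizedIso.prod`), `ComplexTorusKHWeilPairing.lean` §5 (Lange's
Exercise 2.7.4 (6)(c): `weilPairing_pullback`, `proj_mem_kerPhiH_pullback_of_mapMatrix_mem`) and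
`CMTorusEquivariantIsogenies.lean` §1 (`IsIsogeny.exists_unimodular_of_ker_eq`: two isogenies with the same
kernel differ by a unimodular matrix).  Everything is consumed BY NAME.

## Sources, verbatim

A. Iribar López, *Noether–Lefschetz cycles on the moduli space of abelian varieties*, Forum Math. Pi (2026),
held text `paper:arxiv-2411.09910`, §2.2 p. 7 L124–L137 and Def. 4, p. 8 L1–L17:

> "**Lemma 10.** With notation as above, for any antisymplectic isomorphism `p : K(θ_Y) → K(θ_Z)`, the
> abelian variety `(Y × Z)/graph(p)` has a canonical principal polarization `θ_p` and contains `(Y, θ_Y)`,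
> `(Z, θ_Z)` as complementary subvarieties. Moreover, the isomorphism type of `((Y × Z)/graph(p), θ_p)` does
> not depend on `p`, and all principally polarized abelian varieties having `Y` and `Z` as complementary
> subvarieties arise this way."
> "**Definition 4.** If `u ≤ g/2` and `δ = (d₁, …, d_u)` is a polarization type, define the morphism
> `𝒫_{g,δ} : 𝒜^{lev}_{u,δ} × 𝒜^{lev}_{g−u,δ̃} → 𝒜_g` sending the pair `((Y, θ_Y, f_Y), (Z, θ_Z, f_Z))` to
> `((Y × Z)/graph(f_Z ∘ r ∘ f_Y⁻¹), θ_{f_Z ∘ r ∘ f_Y⁻¹})`, where `r : K(δ) → K(δ̃) = K(δ)` is the antisymplectic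
> isomorphism that exchanges the factors […]. The symplectic group of `K(δ)` acts on
> `𝒜^{lev}_{u,δ} × 𝒜^{lev}_{g−u,δ̃}` and `𝒫_{g,δ}` is invariant under this action. Let `𝒜'_{u,g−u,δ}` be the
> quotient by this action. It parametrizes triplets `(X, Y, Z, θ)` where `(X, θ)` is a principally polarized
> abelian variety of dimension `g`, and `Y`, `Z` are complementary subvarieties […]."

R. Auffarth, *On a numerical characterization of non-simple principally polarized abelian varieties*,
Math. Z. 282 (2016), held text `paper:arxiv-1507.08618`, §3 p. 9 L45–L62 and p. 10 L1:

> "`Sp(D)` acts on `𝒜_u(D) × 𝒜_{n−u}(D̃)` by `h·((X, L_X, f), (Y, L_Y, g)) = ((X, L_X, hf), (Y, L_Y, εhε⁻¹g))`.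
> […] **Theorem 3.5.** If `u < n/2`, the morphism `Φ_{u,n−u}(D)` induces an isomorphism
> `(𝒜_u(D) × 𝒜_{n−u}(D̃))/Sp(D) → 𝒜^D_{u,n−u}`. […] *Proof.* Assume `u < n/2`. Then if `h ∈ Sp(D)`,
> `(εhεg)⁻¹εhf = g⁻¹εf` and so this action obviously permutes the fibers of `Φ_{u,n−u}(D)`."

## What this file proves (the EQUIVARIANCE half of row A4-77), and a scope note

For FIXED `(Y, θ_Y)`, `(Z, θ_Z)` the polarised torus `(Y × Z)/graph(p)` does in general depend on `p`; the
clause "does not depend on `p`" is used (Def. 4, Thm. 3.5) and is true in its moduli reading: the construction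
is FUNCTORIAL IN ISOMORPHISMS OF THE DATA.  Precisely, in the tree's analytic carrier (`Y = ComplexTorus Φ₁`
on `E₁` with form `ω₁` of integer Gram matrix `G₁`, `K(θ_Y) = kerPhiH Φ₁ G₁`, the Weil pairing
`ε^{L} = weilPairing Φ₁ ω₁`, and primed copies `Y'`, `Z'`):

* §1 an isomorphism of polarised tori `h : (X, η) ⥲ (X', η')` (`IsPolarizedIso`) carries `K(L)` onto `K(L')`
  (`IsPolarizedIso.apply_mem_kerPhiH_iff`) and preserves the Weil pairings (`IsPolarizedIso.weilPairing_apply`);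
  it restricts to a group isomorphism `K(L) ≃ K(L')` (`IsPolarizedIso.exists_addEquiv_kerPhiH`);
* §2 along such restrictions `e₁ = α|_K`, `e₂ = β|_K` of polarised isomorphisms `α : Y ⥲ Y'`, `β : Z ⥲ Z'`, the
  transported map `p' = e₂ ∘ p ∘ e₁⁻¹` is antisymplectic iff `p` is (`isAntisymplectic_conj_iff`), bijective iff
  `p` is; Def. 4's algebra: composing an antisymplectic map with a symplectic automorphism keeps it
  antisymplectic, and two antisymplectic isomorphisms differ by a symplectic automorphism
  (`IsAntisymplectic.comp_addEquiv`, `IsAntisymplectic.forall_weilPairing_symm_trans`) — the antisymplectic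
  isomorphisms form a torsor under `Sp(K(θ_Y))`, which is why `𝒫_{g,δ}` is `Sp(K(δ))`-invariant;
* §3 GENERAL DESCENT (`IsPolarizedIso.exists_isPolarizedIso_quotientBy`): an isomorphism of polarised tori
  `h : (X, η) ⥲ (X', η')` with `h(Γ) = Γ'` for finite subgroups `Γ`, `Γ'` descends to an isomorphism of the
  polarised quotient tori `k : (X/Γ, η) ⥲ (X'/Γ', η')` with `k ∘ π = π' ∘ h` (the isogenies `π' ∘ h` and `π` have
  the same kernel, so they differ by a unimodular integer matrix whose analytic representation is that of `h`);
* §4 the product isomorphism `α × β` carries `graph(p)` onto `graph(e₂ ∘ p ∘ e₁⁻¹)` (`apply_mem_graphSubgroup_conj_iff`);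
* §5 MAIN (`exists_isPolarizedIso_quotientBy_graphSubgroup_conj`): `α × β` descends to an isomorphism of polarised
  tori `((Y × Z)/graph(p), θ_p) ⥲ ((Y' × Z')/graph(β|_K ∘ p ∘ α|_K⁻¹), θ_{p'})`, `k ∘ π = π' ∘ (α × β)`, carrying
  the image of `Y × 0` onto the image of `Y' × 0` and that of `0 × Z` onto that of `0 × Z'`; in particular
  (`Y' = Y`, `Z' = Z`) for polarised automorphisms `α ∈ Aut(Y, θ_Y)`, `β ∈ Aut(Z, θ_Z)` the twisted products of
  `p` and of `β p α⁻¹` are isomorphic principally polarised tori.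

The CONVERSE ("parametrizes triplets": an isomorphism of the polarised quotients respecting the complementary
pairs comes from such `α`, `β`, and then `p' = β|_K p α|_K⁻¹`) is FILE I of the row.  THEOREMS ONLY; no
definition, no named fact, net debt `0`.

## References

* [IribarLopez2024NoetherLefschetzCycles] A. Iribar López, *Noether–Lefschetz cycles on the moduli space of abelian
  varieties*, Forum Math. Pi (2026), arXiv:2411.09910, §2.2 Lemma 10 (p. 7), Def. 4 (p. 8).
* [Auffarth2016NonSimplePPAV] R. Auffarth, *On a numerical characterization of non-simple principally polarized
  abelian varieties*, Math. Z. 282 (2016) 731–746, arXiv:1507.08618, §3 (pp. 9–10), Thm. 3.5.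
* [Lange2023AbelianVarietiesComplex] H. Lange, *Abelian Varieties over the Complex Numbers* (2023), §1.1.2
  (pp. 19–22: Prop. 1.1.6, isogenies, `X/Γ`, "up to isomorphisms every isogeny is of this type"), §2.4.1 (p. 116:
  automorphisms of polarized abelian varieties), §2.7.1 Lemma 2.7.1, §2.7.4 Exercise (6)(c)
  (`ε^{f^*L}(x, y) = ε^L(f x, f y)`), §3.1.2 Prop. 3.1.4.
-/

noncomputable section

open Complex Module Function Matrix
open scoped Manifold

namespace Literature.Geometry.Kaehler

namespace ComplexTorus

/-- `(B A)_ℝ = B_ℝ A_ℝ` for integer matrices. [folklore] -/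
private theorem map_intCast_mul_TPF {m κ n : Type*} [Fintype κ] (B : Matrix m κ ℤ) (A : Matrix κ n ℤ) :
    (B * A).map (Int.cast : ℤ → ℝ) = B.map (Int.cast : ℤ → ℝ) * A.map (Int.cast : ℤ → ℝ) :=
  Matrix.map_mul (f := Int.castRingHom ℝ)

/-- A pair `v : Fin 2 → E` is `![v 0, v 1]`. [folklore] -/
private theorem eq_vecCons_TPF {F : Type*} (v : Fin 2 → F) : v = ![v 0, v 1] := by
  funext i
  fin_cases i <;> rfl

/-! ### §1 Isomorphisms of polarised tori preserve `K(L)` and the Weil pairing -/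

section KerPhiH

variable {ι ι' : Type*} [Fintype ι] [Fintype ι'] [DecidableEq ι] [DecidableEq ι']
  {E E' : Type*} [NormedAddCommGroup E] [NormedSpace ℂ E] [NormedAddCommGroup E'] [NormedSpace ℂ E']
  {Φ : (ι → ℝ) ≃L[ℝ] E} {Φ' : (ι' → ℝ) ≃L[ℝ] E'} {η : E [⋀^Fin 2]→L[ℝ] ℝ} {η' : E' [⋀^Fin 2]→L[ℝ] ℝ}
  {G : Matrix ι ι ℤ} {G' : Matrix ι' ι' ℤ} {h : ComplexTorus Φ ≃+ ComplexTorus Φ'}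

omit [Fintype ι'] [DecidableEq ι] [DecidableEq ι'] in
/-- **The pulled-back form of an isomorphism of polarised tori is the source form**: if `h = ρ(A)` has the
`ℂ`-linear analytic representation `C` with `C^*η' = η`, then `ρ(A)^*η' = η'.compContinuousLinearMap (realRep Φ Φ' A) = η`
("`φ^*H' = H`"). [cite: Lange2023AbelianVarietiesComplex, §3.1.2 (p. 158–159) and §2.7.4 Exercise (6)(c)] -/
theorem compContinuousLinearMap_realRep_eq_of_analyticRep {A : Matrix ι' ι ℤ} (C : E →L[ℂ] E')
    (hC : ∀ x, Φ' ((A.map (Int.cast : ℤ → ℝ)) *ᵥ x) = C (Φ x))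
    (hη : ∀ u v : E, η' ![C u, C v] = η ![u, v]) :
    η'.compContinuousLinearMap (realRep Φ Φ' A) = η := by
  have hre : ∀ u, realRep Φ Φ' A u = C u := fun u ↦ by
    obtain ⟨x, rfl⟩ := Φ.surjective u
    rw [realRep_apply, hC]
  ext v
  rw [ContinuousAlternatingMap.compContinuousLinearMap_apply, eq_vecCons_TPF (⇑(realRep Φ Φ' A) ∘ v),
    eq_vecCons_TPF v]
  simp only [Function.comp_apply, hre]
  rw [hη]
  rfl

variable (hG : G.map (Int.cast : ℤ → ℝ) = latticeGram Φ η) (hG' : G'.map (Int.cast : ℤ → ℝ) = latticeGram Φ' η')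

include hG hG' in
/-- One direction of `h(K(L)) = K(L')`: `h s ∈ K(L') ⟹ s ∈ K(L)` for an isomorphism of polarised tori
(`h⁻¹(K(L')) ⊆ K(h^*L') = K(L)`, Exercise 2.7.4 (7)(a) with `h^*η' = η`).
[cite: Lange2023AbelianVarietiesComplex, §2.7.4 Exercise (6)(c), (7)(a)] -/
theorem IsPolarizedIso.mem_kerPhiH_of_apply_mem (hh : IsPolarizedIso Φ η Φ' η' h) {s : ComplexTorus Φ}
    (hs : h s ∈ kerPhiH Φ' G') : s ∈ kerPhiH Φ G := by
  obtain ⟨A, B, C, -, -, hA, -, hC, hform⟩ := hh.exists_matrix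
  have hpull := compContinuousLinearMap_realRep_eq_of_analyticRep (η := η) (η' := η') (C : E →L[ℂ] E') hC hform
  have hG₁ : G.map (Int.cast : ℤ → ℝ) = latticeGram Φ (η'.compContinuousLinearMap (realRep Φ Φ' A)) := by
    rw [hpull, hG]
  rw [← proj_lift Φ s] at hs ⊢
  rw [hA] at hs
  exact proj_mem_kerPhiH_pullback_of_mapMatrix_mem Φ Φ' η' A hG' hG₁ hs

include hG hG' in
/-- **An isomorphism of polarised tori carries `K(L)` onto `K(L')`: `h s ∈ K(L') ↔ s ∈ K(L)`** (an
isomorphism of polarized abelian varieties respects `φ_L`, `α̂ φ_{L'} α = φ_L`, hence its kernel).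
[cite: Lange2023AbelianVarietiesComplex, §2.4.1 (p. 116) and §2.7.4 Exercise (6)(c), (7)(a)] [cite: Auffarth2016NonSimplePPAV, §3 ("`K(L_X) ≃ K(D)`"; the action of automorphisms on level structures)] -/
theorem IsPolarizedIso.apply_mem_kerPhiH_iff (hh : IsPolarizedIso Φ η Φ' η' h) (s : ComplexTorus Φ) :
    h s ∈ kerPhiH Φ' G' ↔ s ∈ kerPhiH Φ G := by
  refine ⟨hh.mem_kerPhiH_of_apply_mem hG hG', fun hs ↦ ?_⟩
  have h1 : h.symm (h s) ∈ kerPhiH Φ G := by rwa [h.symm_apply_apply]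
  exact hh.symm.mem_kerPhiH_of_apply_mem hG' hG h1

include hG hG' in
/-- `h(K(L)) = K(L')` as subgroups. [cite: Lange2023AbelianVarietiesComplex, §2.4.1 (p. 116) and §2.7.4 Exercise (7)(a)] -/
theorem IsPolarizedIso.map_kerPhiH_eq (hh : IsPolarizedIso Φ η Φ' η' h) :
    (kerPhiH Φ G).map h.toAddMonoidHom = kerPhiH Φ' G' := by
  ext s'
  constructor
  · rintro ⟨s, hs, rfl⟩
    exact (hh.apply_mem_kerPhiH_iff hG hG' s).2 hs
  · intro hs'
    refine ⟨h.symm s', ?_, h.apply_symm_apply s'⟩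
    exact (hh.apply_mem_kerPhiH_iff hG hG' _).1 (by rwa [h.apply_symm_apply])

include hG hG' in
/-- **An isomorphism of polarised tori preserves the Weil pairings: `ε^{L'}(h s, h t) = ε^L(s, t)` on `K(L)`**
(Exercise 2.7.4 (6)(c), `ε^{f^*L}(x, y) = ε^L(f x, f y)`, with `h^*L' ≡ L`).
[cite: Lange2023AbelianVarietiesComplex, §2.7.4 Exercise (6)(c)] [cite: Auffarth2016NonSimplePPAV, §3 ("`f : K(L_X) → K(D)` is a symplectic isomorphism (that is, preserves the form)")] -/
theorem IsPolarizedIso.weilPairing_apply (hh : IsPolarizedIso Φ η Φ' η' h) {s t : ComplexTorus Φ}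
    (hs : s ∈ kerPhiH Φ G) (ht : t ∈ kerPhiH Φ G) :
    weilPairing Φ' η' (h s) (h t) = weilPairing Φ η s t := by
  obtain ⟨A, B, C, -, -, hA, -, hC, hform⟩ := hh.exists_matrix
  have hpull := compContinuousLinearMap_realRep_eq_of_analyticRep (η := η) (η' := η') (C : E →L[ℂ] E') hC hform
  have hG₁ : G.map (Int.cast : ℤ → ℝ) = latticeGram Φ (η'.compContinuousLinearMap (realRep Φ Φ' A)) := by
    rw [hpull, hG]
  have hs' : h s ∈ kerPhiH Φ' G' := (hh.apply_mem_kerPhiH_iff hG hG' s).2 hs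
  have ht' : h t ∈ kerPhiH Φ' G' := (hh.apply_mem_kerPhiH_iff hG hG' t).2 ht
  obtain ⟨x, rfl⟩ : ∃ x, proj Φ x = s := ⟨lift Φ s, proj_lift Φ s⟩
  obtain ⟨y, rfl⟩ : ∃ y, proj Φ y = t := ⟨lift Φ t, proj_lift Φ t⟩
  rw [hA] at hs' ht' ⊢
  have key := weilPairing_pullback Φ Φ' η' A hG' hG₁ hs' ht'
  rw [hpull] at key
  exact key.symm

include hG hG' in
/-- **The restriction `h|_K : K(L) ≃ K(L')`** of an isomorphism of polarised tori, as a group isomorphism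
compatible with `h` ("`(X, L_X, f) ↦ (X, L_X, hf)`": automorphisms act on level structures through their
restriction to `K(L)`). [cite: Auffarth2016NonSimplePPAV, §3 (p. 9)] [cite: Lange2023AbelianVarietiesComplex, §2.4.1 (p. 116)] -/
theorem IsPolarizedIso.exists_addEquiv_kerPhiH (hh : IsPolarizedIso Φ η Φ' η' h) :
    ∃ e : kerPhiH Φ G ≃+ kerPhiH Φ' G', ∀ s, (e s : ComplexTorus Φ') = h s := by
  refine ⟨{ toFun := fun s ↦ ⟨h s, (hh.apply_mem_kerPhiH_iff hG hG' _).2 s.2⟩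
            invFun := fun s' ↦ ⟨h.symm s', (hh.apply_mem_kerPhiH_iff hG hG' _).1
              (by rw [h.apply_symm_apply]; exact s'.2)⟩
            left_inv := fun s ↦ Subtype.ext (h.symm_apply_apply _)
            right_inv := fun s' ↦ Subtype.ext (h.apply_symm_apply _)
            map_add' := fun s t ↦ Subtype.ext (by simp) }, fun s ↦ rfl⟩

end KerPhiH

/-! ### §2 Transport of antisymplectic maps along isomorphisms of the factors; Def. 4's algebra -/

section Transport

variable {ι₁ ι₂ ι₁' ι₂' : Type*} [Fintype ι₁] [Fintype ι₂] [Fintype ι₁'] [Fintype ι₂']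
  [DecidableEq ι₁] [DecidableEq ι₂] [DecidableEq ι₁'] [DecidableEq ι₂']
  {E₁ E₂ E₁' E₂' : Type*} [NormedAddCommGroup E₁] [NormedSpace ℂ E₁] [NormedAddCommGroup E₂] [NormedSpace ℂ E₂]
  [NormedAddCommGroup E₁'] [NormedSpace ℂ E₁'] [NormedAddCommGroup E₂'] [NormedSpace ℂ E₂']
  {Φ₁ : (ι₁ → ℝ) ≃L[ℝ] E₁} {Φ₂ : (ι₂ → ℝ) ≃L[ℝ] E₂} {Φ₁' : (ι₁' → ℝ) ≃L[ℝ] E₁'} {Φ₂' : (ι₂' → ℝ) ≃L[ℝ] E₂'}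
  {ω₁ : E₁ [⋀^Fin 2]→L[ℝ] ℝ} {ω₂ : E₂ [⋀^Fin 2]→L[ℝ] ℝ} {ω₁' : E₁' [⋀^Fin 2]→L[ℝ] ℝ} {ω₂' : E₂' [⋀^Fin 2]→L[ℝ] ℝ}
  {G₁ : Matrix ι₁ ι₁ ℤ} {G₂ : Matrix ι₂ ι₂ ℤ} {G₁' : Matrix ι₁' ι₁' ℤ} {G₂' : Matrix ι₂' ι₂' ℤ}
  {h₁ : ComplexTorus Φ₁ ≃+ ComplexTorus Φ₁'} {h₂ : ComplexTorus Φ₂ ≃+ ComplexTorus Φ₂'}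
  {e₁ : kerPhiH Φ₁ G₁ ≃+ kerPhiH Φ₁' G₁'} {e₂ : kerPhiH Φ₂ G₂ ≃+ kerPhiH Φ₂' G₂'}

/-- Bijectivity is transported: `e₂ ∘ p ∘ e₁⁻¹` is bijective iff `p` is (the `Sp(D)`-action / isomorphisms of
level-structured pairs move `g⁻¹εf` to another ISOMORPHISM `K(L_X) ≅ K(L_Y)`). [cite: Auffarth2016NonSimplePPAV, §3 (p. 9: "`h·((X, L_X, f), (Y, L_Y, g)) = ((X, L_X, hf), (Y, L_Y, εhε⁻¹g))`")] -/
theorem bijective_conj_iff (p : kerPhiH Φ₁ G₁ →+ kerPhiH Φ₂ G₂) :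
    Bijective (e₂.toAddMonoidHom.comp (p.comp e₁.symm.toAddMonoidHom)) ↔ Bijective p := by
  change Bijective (⇑e₂ ∘ (⇑p ∘ ⇑e₁.symm)) ↔ Bijective p
  rw [Function.Bijective.of_comp_iff' e₂.bijective, Function.Bijective.of_comp_iff p e₁.symm.bijective]

variable (hG₁ : G₁.map (Int.cast : ℤ → ℝ) = latticeGram Φ₁ ω₁) (hG₂ : G₂.map (Int.cast : ℤ → ℝ) = latticeGram Φ₂ ω₂)
  (hG₁' : G₁'.map (Int.cast : ℤ → ℝ) = latticeGram Φ₁' ω₁') (hG₂' : G₂'.map (Int.cast : ℤ → ℝ) = latticeGram Φ₂' ω₂')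
  (hh₁ : IsPolarizedIso Φ₁ ω₁ Φ₁' ω₁' h₁) (hh₂ : IsPolarizedIso Φ₂ ω₂ Φ₂' ω₂' h₂)
  (he₁ : ∀ s, (e₁ s : ComplexTorus Φ₁') = h₁ s) (he₂ : ∀ s, (e₂ s : ComplexTorus Φ₂') = h₂ s)

include hG₁ hG₂ hG₁' hG₂' hh₁ hh₂ he₁ he₂ in
/-- **Transport of antisymplectic maps.**  For polarised isomorphisms `α = h₁ : (Y, ω₁) ⥲ (Y', ω₁')`,
`β = h₂ : (Z, ω₂) ⥲ (Z', ω₂')` with restrictions `e₁ = α|_K : K(L₁) ≃ K(L₁')`, `e₂ = β|_K : K(L₂) ≃ K(L₂')`, the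
transported map `p' = β|_K ∘ p ∘ α|_K⁻¹ : K(L₁') → K(L₂')` is antisymplectic iff `p` is (both `α|_K`, `β|_K`
preserve the Weil pairings) — Def. 4's `f_Z ∘ r ∘ f_Y⁻¹` transported along isomorphisms of the level-structured
factors. [cite: IribarLopez2024NoetherLefschetzCycles, §2.2 Def. 4 (p. 8)] [cite: Auffarth2016NonSimplePPAV, §3 (p. 9: "`(X × Y)/Γ_{g⁻¹εf}`")] -/
theorem isAntisymplectic_conj_iff (p : kerPhiH Φ₁ G₁ →+ kerPhiH Φ₂ G₂) :
    IsAntisymplectic ω₁' ω₂' (e₂.toAddMonoidHom.comp (p.comp e₁.symm.toAddMonoidHom)) ↔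
      IsAntisymplectic ω₁ ω₂ p := by
  rw [isAntisymplectic_iff, isAntisymplectic_iff]
  have key : ∀ s' t' : kerPhiH Φ₁' G₁',
      (weilPairing Φ₂' ω₂' ((e₂.toAddMonoidHom.comp (p.comp e₁.symm.toAddMonoidHom)) s' : ComplexTorus Φ₂')
          ((e₂.toAddMonoidHom.comp (p.comp e₁.symm.toAddMonoidHom)) t') =
        (weilPairing Φ₁' ω₁' (s' : ComplexTorus Φ₁') t')⁻¹) ↔
      (weilPairing Φ₂ ω₂ (p (e₁.symm s') : ComplexTorus Φ₂) (p (e₁.symm t')) =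
        (weilPairing Φ₁ ω₁ ((e₁.symm s' : kerPhiH Φ₁ G₁) : ComplexTorus Φ₁) (e₁.symm t'))⁻¹) := by
    intro s' t'
    simp only [AddMonoidHom.coe_comp, AddEquiv.coe_toAddMonoidHom, Function.comp_apply]
    rw [he₂, he₂, hh₂.weilPairing_apply hG₂ hG₂' (p (e₁.symm s')).2 (p (e₁.symm t')).2]
    have hs' : (s' : ComplexTorus Φ₁') = h₁ ((e₁.symm s' : kerPhiH Φ₁ G₁) : ComplexTorus Φ₁) := by
      rw [← he₁, e₁.apply_symm_apply]
    have ht' : (t' : ComplexTorus Φ₁') = h₁ ((e₁.symm t' : kerPhiH Φ₁ G₁) : ComplexTorus Φ₁) := by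
      rw [← he₁, e₁.apply_symm_apply]
    rw [hs', ht', hh₁.weilPairing_apply hG₁ hG₁' (e₁.symm s').2 (e₁.symm t').2]
  constructor
  · intro h s t
    have := (key (e₁ s) (e₁ t)).1 (h (e₁ s) (e₁ t))
    simpa only [AddEquiv.symm_apply_apply] using this
  · intro h s' t'
    exact (key s' t').2 (h _ _)

omit [Fintype ι₂] [DecidableEq ι₂] in
/-- **Def. 4's algebra, (a): antisymplectic ∘ symplectic = antisymplectic.**  If `σ` is a SYMPLECTIC
automorphism of `K(L₁)` (it preserves `ε^{L₁}`) and `p : K(L₁) → K₂` is antisymplectic, so is `p ∘ σ`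
("if `h ∈ Sp(D)`, `(εhεg)⁻¹εhf = g⁻¹εf` … this action obviously permutes the fibers").
[cite: Auffarth2016NonSimplePPAV, §3 Thm. 3.5 (proof, p. 10 L1)] [cite: IribarLopez2024NoetherLefschetzCycles, §2.2 Def. 4 ("`𝒫_{g,δ}` is invariant under this action")] -/
theorem IsAntisymplectic.comp_addEquiv {K₂ : AddSubgroup (ComplexTorus Φ₂)} {p : kerPhiH Φ₁ G₁ →+ K₂}
    (hp : IsAntisymplectic ω₁ ω₂ p) {σ : kerPhiH Φ₁ G₁ ≃+ kerPhiH Φ₁ G₁}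
    (hσ : ∀ s t : kerPhiH Φ₁ G₁, weilPairing Φ₁ ω₁ (σ s : ComplexTorus Φ₁) (σ t) =
      weilPairing Φ₁ ω₁ (s : ComplexTorus Φ₁) t) :
    IsAntisymplectic ω₁ ω₂ (p.comp σ.toAddMonoidHom) := by
  intro s t
  simp only [AddMonoidHom.coe_comp, AddEquiv.coe_toAddMonoidHom, Function.comp_apply]
  rw [hp (σ s) (σ t), hσ]

omit [Fintype ι₂] [DecidableEq ι₂] in
/-- **Def. 4's algebra, (b): two antisymplectic isomorphisms `p, q : K(L₁) ≃ K(L₂)` differ by a SYMPLECTIC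
automorphism `p⁻¹ ∘ q` of `K(L₁)`** — the antisymplectic isomorphisms form a torsor under `Sp(K(L₁))`, so the
`Sp(K(δ))`-quotient of Def. 4 forgets exactly the choice of `p` ("`(f₂, g₂) = ((εg₂g₁⁻¹ε)f₁, (εg₂g₁⁻¹ε)g₁)`").
[cite: Auffarth2016NonSimplePPAV, §3 Thm. 3.5 (proof, p. 10)] [cite: IribarLopez2024NoetherLefschetzCycles, §2.2 Def. 4] -/
theorem IsAntisymplectic.forall_weilPairing_symm_trans {K₂ : AddSubgroup (ComplexTorus Φ₂)}
    {p q : kerPhiH Φ₁ G₁ ≃+ K₂} (hp : IsAntisymplectic ω₁ ω₂ p.toAddMonoidHom)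
    (hq : IsAntisymplectic ω₁ ω₂ q.toAddMonoidHom) (s t : kerPhiH Φ₁ G₁) :
    weilPairing Φ₁ ω₁ ((q.trans p.symm) s : ComplexTorus Φ₁) ((q.trans p.symm) t) =
      weilPairing Φ₁ ω₁ (s : ComplexTorus Φ₁) t := by
  have h1 := hp (p.symm (q s)) (p.symm (q t))
  have h2 := hq s t
  simp only [AddEquiv.toAddMonoidHom_eq_coe, AddMonoidHom.coe_coe, AddEquiv.apply_symm_apply] at h1 h2
  rw [AddEquiv.trans_apply, AddEquiv.trans_apply]
  rw [h2] at h1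
  exact (inv_injective h1).symm

end Transport

/-! ### §3 Descent of isomorphisms of polarised tori to quotients by corresponding finite subgroups -/

section Descent

variable {ι ι' : Type*} [Fintype ι] [Fintype ι'] [DecidableEq ι] [DecidableEq ι']
  {E E' : Type*} [NormedAddCommGroup E] [NormedSpace ℂ E] [NormedAddCommGroup E'] [NormedSpace ℂ E']
  {Φ : (ι → ℝ) ≃L[ℝ] E} {Φ' : (ι' → ℝ) ≃L[ℝ] E'} {η : E [⋀^Fin 2]→L[ℝ] ℝ} {η' : E' [⋀^Fin 2]→L[ℝ] ℝ}
  {h : ComplexTorus Φ ≃+ ComplexTorus Φ'}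

omit [Fintype ι'] [DecidableEq ι] [DecidableEq ι'] in
/-- A group isomorphism of tori of the form `h = ρ(A)` with a `ℂ`-linear analytic representation is an isogeny
(holomorphic, onto, kernel `0`). [cite: Lange2023AbelianVarietiesComplex, §1.1.2 (definition of an isogeny, p. 21) and §3.1.2 (p. 158)] -/
theorem isIsogeny_of_addEquiv_coe_eq (h : ComplexTorus Φ ≃+ ComplexTorus Φ') {A : Matrix ι' ι ℤ}
    (hA : ⇑h = mapMatrix Φ Φ' A) {C : E →L[ℂ] E'} (hC : ∀ x, Φ' ((A.map (Int.cast : ℤ → ℝ)) *ᵥ x) = C (Φ x)) :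
    IsIsogeny Φ Φ' A := by
  refine ⟨⟨C, hC⟩, ?_, ?_⟩
  · rw [← hA]; exact h.surjective
  · have hbot : (mapMatrixHom Φ Φ' A).ker = ⊥ := by
      rw [eq_bot_iff]
      intro t ht
      rw [AddMonoidHom.mem_ker, mapMatrixHom_apply, ← hA] at ht
      rw [AddSubgroup.mem_bot]
      exact h.injective (by rw [ht, map_zero])
    rw [hbot]
    infer_instance

/-- **Descent of an isomorphism of polarised tori to the quotients.**  Let `h : (X, η) ⥲ (X', η')` be an
isomorphism of polarised tori and `Γ ⊆ X`, `Γ' ⊆ X'` finite subgroups with `h(Γ) = Γ'` (`h t ∈ Γ' ↔ t ∈ Γ`).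
Then there is an isomorphism of the POLARISED quotient tori `k : (X/Γ, η) ⥲ (X'/Γ', η')` (the quotients on
the same covering spaces, `quotientByPeriod`, polarised by the same forms) with `k ∘ π = π' ∘ h` for the
natural projections.  Proof: `π' ∘ h` and `π` are isogenies of `X` with the same kernel `Γ`, so ("up to
isomorphisms every isogeny is of this type") they differ by an integer matrix invertible over `ℤ` whose analytic
representation is that of `h`, which pulls `η'` back to `η`. [cite: Lange2023AbelianVarietiesComplex, §1.1.2 (pp. 21–22) and §3.1.2 Prop. 3.1.4 (p. 160)] [cite: Auffarth2016NonSimplePPAV, §3 Thm. 3.5 (proof: "by descent theory for abelian varieties")] -/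
theorem IsPolarizedIso.exists_isPolarizedIso_quotientBy (hh : IsPolarizedIso Φ η Φ' η' h)
    (Γ : AddSubgroup (ComplexTorus Φ)) (Γ' : AddSubgroup (ComplexTorus Φ')) [Finite Γ] [Finite Γ']
    (hΓ : ∀ t, h t ∈ Γ' ↔ t ∈ Γ) :
    ∃ k : ComplexTorus (quotientByPeriod Φ Γ) ≃+ ComplexTorus (quotientByPeriod Φ' Γ'),
      IsPolarizedIso (quotientByPeriod Φ Γ) η (quotientByPeriod Φ' Γ') η' k ∧
        ∀ t, k (mapMatrix Φ (quotientByPeriod Φ Γ) (quotientMatrix Φ Γ) t) =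
          mapMatrix Φ' (quotientByPeriod Φ' Γ') (quotientMatrix Φ' Γ') (h t) := by
  obtain ⟨A, B, C, -, -, hA, -, hC, hform⟩ := hh.exists_matrix
  have hhA : IsIsogeny Φ Φ' A := isIsogeny_of_addEquiv_coe_eq h hA (C := (C : E →L[ℂ] E')) hC
  have hπ := isIsogeny_quotientBy Φ Γ
  have hcomp : IsIsogeny Φ (quotientByPeriod Φ' Γ') (quotientMatrix Φ' Γ' * A) :=
    IsIsogeny.mul Φ Φ' (quotientByPeriod Φ' Γ') (isIsogeny_quotientBy Φ' Γ') hhA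
  have hker : (mapMatrixHom Φ (quotientByPeriod Φ Γ) (quotientMatrix Φ Γ)).ker =
      (mapMatrixHom Φ (quotientByPeriod Φ' Γ') (quotientMatrix Φ' Γ' * A)).ker := by
    rw [ker_mapMatrixHom_quotientBy]
    ext t
    rw [← hΓ t, ← SetLike.ext_iff.1 (ker_mapMatrixHom_quotientBy Φ' Γ') (h t), AddMonoidHom.mem_ker,
      AddMonoidHom.mem_ker, mapMatrixHom_apply, mapMatrixHom_apply,
      ← mapMatrix_mapMatrix (Φ := Φ) (Φ' := Φ') (Φ'' := quotientByPeriod Φ' Γ') (quotientMatrix Φ' Γ') A t, hA]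
  obtain ⟨C₀, C₀', hC₀, -, hC₀'C₀, hC₀C₀', ⟨g, hg⟩, -⟩ := hπ.exists_unimodular_of_ker_eq hcomp hker
  -- the analytic representation `g` of `ρ(C₀)` is that of `h`
  have hgC : ∀ u, g u = C u := fun u ↦ by
    obtain ⟨x, rfl⟩ := Φ.surjective u
    have h1 := hg ((quotientMatrix Φ Γ).map (Int.cast : ℤ → ℝ) *ᵥ x)
    rw [quotientPeriod_mulVec, Matrix.mulVec_mulVec, ← map_intCast_mul_TPF, hC₀, map_intCast_mul_TPF,
      ← Matrix.mulVec_mulVec, quotientPeriod_mulVec, hC] at h1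
    exact h1.symm
  obtain ⟨k, hk, hcoe, -⟩ := exists_isPolarizedIso_of_matrix hC₀'C₀ hC₀C₀' g hg fun u v ↦ by
    rw [hgC, hgC, hform]
  refine ⟨k, hk, fun t ↦ ?_⟩
  rw [hcoe, mapMatrix_mapMatrix, hC₀,
    ← mapMatrix_mapMatrix (Φ := Φ) (Φ' := Φ') (Φ'' := quotientByPeriod Φ' Γ') (quotientMatrix Φ' Γ') A t, hA]

omit [Fintype ι] [Fintype ι'] [DecidableEq ι] [DecidableEq ι'] in
/-- The descended isomorphism carries `π(S)` onto `π'(h(S))` for every subgroup `S ⊆ X` (used for the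
complementary pairs). [cite: Lange2023AbelianVarietiesComplex, §1.1.2 (pp. 21–22)] -/
theorem map_map_eq_map_map_of_comp_eq {Y Y' : Type*} [AddCommGroup Y] [AddCommGroup Y']
    (π : ComplexTorus Φ →+ Y) (π' : ComplexTorus Φ' →+ Y') (k : Y ≃+ Y') (hk : ∀ t, k (π t) = π' (h t))
    (S : AddSubgroup (ComplexTorus Φ)) :
    (S.map π).map k.toAddMonoidHom = (S.map h.toAddMonoidHom).map π' := by
  ext y'
  simp only [AddSubgroup.mem_map, AddEquiv.coe_toAddMonoidHom, exists_exists_and_eq_and]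
  constructor
  · rintro ⟨t, ht, rfl⟩
    exact ⟨t, ht, (hk t).symm⟩
  · rintro ⟨t, ht, rfl⟩
    exact ⟨t, ht, hk t⟩

end Descent

/-! ### §4 The product isomorphism `α × β` carries `graph(p)` onto `graph(β|_K ∘ p ∘ α|_K⁻¹)` -/

section Graph

variable {ι₁ ι₂ ι₁' ι₂' : Type*} [Fintype ι₁] [Fintype ι₂] [Fintype ι₁'] [Fintype ι₂']
  {E₁ E₂ E₁' E₂' : Type*} [NormedAddCommGroup E₁] [NormedSpace ℂ E₁] [NormedAddCommGroup E₂] [NormedSpace ℂ E₂]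
  [NormedAddCommGroup E₁'] [NormedSpace ℂ E₁'] [NormedAddCommGroup E₂'] [NormedSpace ℂ E₂']
  {Φ₁ : (ι₁ → ℝ) ≃L[ℝ] E₁} {Φ₂ : (ι₂ → ℝ) ≃L[ℝ] E₂} {Φ₁' : (ι₁' → ℝ) ≃L[ℝ] E₁'} {Φ₂' : (ι₂' → ℝ) ≃L[ℝ] E₂'}
  {K₁ : AddSubgroup (ComplexTorus Φ₁)} {K₂ : AddSubgroup (ComplexTorus Φ₂)}
  {K₁' : AddSubgroup (ComplexTorus Φ₁')} {K₂' : AddSubgroup (ComplexTorus Φ₂')}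
  {h₁ : ComplexTorus Φ₁ ≃+ ComplexTorus Φ₁'} {h₂ : ComplexTorus Φ₂ ≃+ ComplexTorus Φ₂'}
  {e₁ : K₁ ≃+ K₁'} {e₂ : K₂ ≃+ K₂'}
  (he₁ : ∀ s, (e₁ s : ComplexTorus Φ₁') = h₁ s) (he₂ : ∀ s, (e₂ s : ComplexTorus Φ₂') = h₂ s)
  {h : ComplexTorus (prodPeriod Φ₁ Φ₂) ≃+ ComplexTorus (prodPeriod Φ₁' Φ₂')}
  (hc : ∀ t, prodHomeomorph Φ₁' Φ₂' (h t) = (h₁ (prodHomeomorph Φ₁ Φ₂ t).1, h₂ (prodHomeomorph Φ₁ Φ₂ t).2))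

omit [Fintype ι₁] [Fintype ι₁'] in
include he₁ in
/-- A restriction `e₁` of `h₁` to `K₁ ≃ K₁'` detects membership: `h₁ s ∈ K₁' ↔ s ∈ K₁` (an isomorphism
restricted to the finite groups `K(L_X) ≃ K(D)` of level structures). [cite: Auffarth2016NonSimplePPAV, §3 (p. 9: "`f : K(L_X) → K(D)` is a symplectic isomorphism")] -/
theorem apply_mem_iff_of_restrict (s : ComplexTorus Φ₁) : h₁ s ∈ K₁' ↔ s ∈ K₁ := by
  constructor
  · intro hs
    have h1 : h₁ ((e₁.symm ⟨h₁ s, hs⟩ : K₁) : ComplexTorus Φ₁) = h₁ s := by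
      rw [← he₁, e₁.apply_symm_apply]
    rw [← h₁.injective h1]
    exact (e₁.symm ⟨h₁ s, hs⟩).2
  · intro hs
    have h1 := he₁ ⟨s, hs⟩
    rw [← h1]
    exact (e₁ ⟨s, hs⟩).2

include he₁ he₂ hc in
/-- **`(α × β)(graph(p)) = graph(β|_K ∘ p ∘ α|_K⁻¹)`**: a point `t` of `Y × Z` lies on the graph of
`p : K₁ → K₂` iff `(α × β)(t)` lies on the graph of the transported map `e₂ ∘ p ∘ e₁⁻¹ : K₁' → K₂'`
("the subgroups of `X × Y` (that is, the graphs) induced by `g₁⁻¹εf₁` and `g₂⁻¹εf₂`").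
[cite: Auffarth2016NonSimplePPAV, §3 Thm. 3.5 (proof, p. 10)] [cite: IribarLopez2024NoetherLefschetzCycles, §2.2 Def. 4] -/
theorem apply_mem_graphSubgroup_conj_iff (p : K₁ →+ K₂) (t : ComplexTorus (prodPeriod Φ₁ Φ₂)) :
    h t ∈ graphSubgroup K₁' K₂' (e₂.toAddMonoidHom.comp (p.comp e₁.symm.toAddMonoidHom)) ↔
      t ∈ graphSubgroup K₁ K₂ p := by
  rw [mem_graphSubgroup_iff_exists, mem_graphSubgroup_iff_exists, hc]
  simp only [AddMonoidHom.coe_comp, AddEquiv.coe_toAddMonoidHom, Function.comp_apply]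
  constructor
  · rintro ⟨hs', h2⟩
    have hs : (prodHomeomorph Φ₁ Φ₂ t).1 ∈ K₁ := (apply_mem_iff_of_restrict he₁ _).1 hs'
    refine ⟨hs, h₂.injective ?_⟩
    have h3 : e₁.symm ⟨h₁ (prodHomeomorph Φ₁ Φ₂ t).1, hs'⟩ = ⟨(prodHomeomorph Φ₁ Φ₂ t).1, hs⟩ := by
      rw [AddEquiv.symm_apply_eq]
      exact Subtype.ext (by simp [he₁])
    rw [h2, h3, he₂]
  · rintro ⟨hs, h2⟩
    have hs' : h₁ (prodHomeomorph Φ₁ Φ₂ t).1 ∈ K₁' := (apply_mem_iff_of_restrict he₁ _).2 hs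
    refine ⟨hs', ?_⟩
    have h3 : e₁.symm ⟨h₁ (prodHomeomorph Φ₁ Φ₂ t).1, hs'⟩ = ⟨(prodHomeomorph Φ₁ Φ₂ t).1, hs⟩ := by
      rw [AddEquiv.symm_apply_eq]
      exact Subtype.ext (by simp [he₁])
    rw [h2, h3, he₂]

include hc in
/-- `α × β` carries `Y × 0` onto `Y' × 0`: `h t ∈ Y' × 0 ↔ t ∈ Y × 0`. [cite: Lange2023AbelianVarietiesComplex, §2.4.4 Cor. 2.4.24 (p. 123)] -/
theorem apply_mem_subtorus_fstSubspace_iff (t : ComplexTorus (prodPeriod Φ₁ Φ₂)) :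
    h t ∈ subtorus (prodPeriod Φ₁' Φ₂') (fstSubspace : Submodule ℝ (ι₁' ⊕ ι₂' → ℝ)) ↔
      t ∈ subtorus (prodPeriod Φ₁ Φ₂) (fstSubspace : Submodule ℝ (ι₁ ⊕ ι₂ → ℝ)) := by
  rw [mem_subtorus_fstSubspace_iff, mem_subtorus_fstSubspace_iff, hc]
  exact h₂.map_eq_zero_iff (x := (prodHomeomorph Φ₁ Φ₂ t).2)

include hc in
/-- `α × β` carries `0 × Z` onto `0 × Z'`: `h t ∈ 0 × Z' ↔ t ∈ 0 × Z`. [cite: Lange2023AbelianVarietiesComplex, §2.4.4 Cor. 2.4.24 (p. 123)] -/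
theorem apply_mem_subtorus_sndSubspace_iff (t : ComplexTorus (prodPeriod Φ₁ Φ₂)) :
    h t ∈ subtorus (prodPeriod Φ₁' Φ₂') (sndSubspace : Submodule ℝ (ι₁' ⊕ ι₂' → ℝ)) ↔
      t ∈ subtorus (prodPeriod Φ₁ Φ₂) (sndSubspace : Submodule ℝ (ι₁ ⊕ ι₂ → ℝ)) := by
  rw [mem_subtorus_sndSubspace_iff, mem_subtorus_sndSubspace_iff, hc]
  exact h₁.map_eq_zero_iff (x := (prodHomeomorph Φ₁ Φ₂ t).1)

include hc in
/-- `(α × β)(Y × 0) = Y' × 0` as subgroups. [cite: Lange2023AbelianVarietiesComplex, §2.4.4 Cor. 2.4.24 (p. 123)] -/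
theorem map_subtorus_fstSubspace_eq :
    (subtorus (prodPeriod Φ₁ Φ₂) (fstSubspace : Submodule ℝ (ι₁ ⊕ ι₂ → ℝ))).map h.toAddMonoidHom =
      subtorus (prodPeriod Φ₁' Φ₂') (fstSubspace : Submodule ℝ (ι₁' ⊕ ι₂' → ℝ)) := by
  ext t'
  constructor
  · rintro ⟨t, ht, rfl⟩
    exact (apply_mem_subtorus_fstSubspace_iff hc t).2 ht
  · intro ht'
    exact ⟨h.symm t', (apply_mem_subtorus_fstSubspace_iff hc _).1 (by rwa [h.apply_symm_apply]),
      h.apply_symm_apply t'⟩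

include hc in
/-- `(α × β)(0 × Z) = 0 × Z'` as subgroups. [cite: Lange2023AbelianVarietiesComplex, §2.4.4 Cor. 2.4.24 (p. 123)] -/
theorem map_subtorus_sndSubspace_eq :
    (subtorus (prodPeriod Φ₁ Φ₂) (sndSubspace : Submodule ℝ (ι₁ ⊕ ι₂ → ℝ))).map h.toAddMonoidHom =
      subtorus (prodPeriod Φ₁' Φ₂') (sndSubspace : Submodule ℝ (ι₁' ⊕ ι₂' → ℝ)) := by
  ext t'
  constructor
  · rintro ⟨t, ht, rfl⟩
    exact (apply_mem_subtorus_sndSubspace_iff hc t).2 ht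
  · intro ht'
    exact ⟨h.symm t', (apply_mem_subtorus_sndSubspace_iff hc _).1 (by rwa [h.apply_symm_apply]),
      h.apply_symm_apply t'⟩

end Graph

/-! ### §5 Debarre's construction is functorial: `(Y × Z)/graph(p) ≅ (Y' × Z')/graph(β|_K p α|_K⁻¹)` as
polarised tori -/

section Main

variable {ι₁ ι₂ ι₁' ι₂' : Type*} [Fintype ι₁] [Fintype ι₂] [Fintype ι₁'] [Fintype ι₂']
  [DecidableEq ι₁] [DecidableEq ι₂] [DecidableEq ι₁'] [DecidableEq ι₂']
  {E₁ E₂ E₁' E₂' : Type*} [NormedAddCommGroup E₁] [NormedSpace ℂ E₁] [NormedAddCommGroup E₂] [NormedSpace ℂ E₂]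
  [NormedAddCommGroup E₁'] [NormedSpace ℂ E₁'] [NormedAddCommGroup E₂'] [NormedSpace ℂ E₂']
  {Φ₁ : (ι₁ → ℝ) ≃L[ℝ] E₁} {Φ₂ : (ι₂ → ℝ) ≃L[ℝ] E₂} {Φ₁' : (ι₁' → ℝ) ≃L[ℝ] E₁'} {Φ₂' : (ι₂' → ℝ) ≃L[ℝ] E₂'}
  {ω₁ : E₁ [⋀^Fin 2]→L[ℝ] ℝ} {ω₂ : E₂ [⋀^Fin 2]→L[ℝ] ℝ} {ω₁' : E₁' [⋀^Fin 2]→L[ℝ] ℝ} {ω₂' : E₂' [⋀^Fin 2]→L[ℝ] ℝ}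
  {K₁ : AddSubgroup (ComplexTorus Φ₁)} {K₂ : AddSubgroup (ComplexTorus Φ₂)}
  {K₁' : AddSubgroup (ComplexTorus Φ₁')} {K₂' : AddSubgroup (ComplexTorus Φ₂')}
  {h₁ : ComplexTorus Φ₁ ≃+ ComplexTorus Φ₁'} {h₂ : ComplexTorus Φ₂ ≃+ ComplexTorus Φ₂'}
  (hh₁ : IsPolarizedIso Φ₁ ω₁ Φ₁' ω₁' h₁) (hh₂ : IsPolarizedIso Φ₂ ω₂ Φ₂' ω₂' h₂)
  {e₁ : K₁ ≃+ K₁'} {e₂ : K₂ ≃+ K₂'}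
  (he₁ : ∀ s, (e₁ s : ComplexTorus Φ₁') = h₁ s) (he₂ : ∀ s, (e₂ s : ComplexTorus Φ₂') = h₂ s)
  (p : K₁ →+ K₂) [Finite (graphSubgroup K₁ K₂ p)]
  [Finite (graphSubgroup K₁' K₂' (e₂.toAddMonoidHom.comp (p.comp e₁.symm.toAddMonoidHom)))]

include hh₁ hh₂ in
/-- The product `α × β` of two isomorphisms of polarised tori, with its action on components.
[cite: Lange2023AbelianVarietiesComplex, §1.1.2 Prop. 1.1.6 (pp. 19–20) and §3.1.2 Prop. 3.1.4 (p. 160)] -/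
theorem exists_isPolarizedIso_prod_prodHomeomorph :
    ∃ h : ComplexTorus (prodPeriod Φ₁ Φ₂) ≃+ ComplexTorus (prodPeriod Φ₁' Φ₂'),
      IsPolarizedIso (prodPeriod Φ₁ Φ₂) (prodForm ω₁ ω₂) (prodPeriod Φ₁' Φ₂') (prodForm ω₁' ω₂') h ∧
        ∀ t, prodHomeomorph Φ₁' Φ₂' (h t) = (h₁ (prodHomeomorph Φ₁ Φ₂ t).1, h₂ (prodHomeomorph Φ₁ Φ₂ t).2) := by
  classical
  obtain ⟨A₁, A₂, h, hA₁, hA₂, hh, hcoe⟩ := hh₁.prod hh₂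
  refine ⟨h, hh, fun t ↦ ?_⟩
  rw [hcoe, prodHomeomorph_mapMatrix_fromBlocks, ← hA₁, ← hA₂]

include hh₁ hh₂ he₁ he₂ in
/-- **Iribar López 2024, Lemma 10 / Def. 4 — Debarre's construction is functorial in the data.**  Let
`α = h₁ : (Y, ω₁) ⥲ (Y', ω₁')` and `β = h₂ : (Z, ω₂) ⥲ (Z', ω₂')` be isomorphisms of polarised complex tori, with
restrictions `e₁ : K₁ ≃ K₁'`, `e₂ : K₂ ≃ K₂'` to subgroups (`K(L)`'s: `IsPolarizedIso.exists_addEquiv_kerPhiH`), and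
let `p : K₁ → K₂` be a homomorphism with finite graph, `p' := e₂ ∘ p ∘ e₁⁻¹ : K₁' → K₂'` its transport.  Then
`α × β` is an isomorphism of the polarised product tori `(Y × Z, ω₁ ⊞ ω₂) ⥲ (Y' × Z', ω₁' ⊞ ω₂')` and DESCENDS to an
isomorphism of polarised tori `k : ((Y × Z)/graph(p), ω₁ ⊞ ω₂) ⥲ ((Y' × Z')/graph(p'), ω₁' ⊞ ω₂')` with
`k ∘ π = π' ∘ (α × β)`.  With A4-76 (`isPrincipalPolarization_quotientBy_graphSubgroup`: for antisymplectic
isomorphisms `p` of `K(θ_Y) ≅ K(θ_Z)` these are Debarre's principally polarised `θ_p`, `θ_{p'}`, and `p'` is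
antisymplectic by `isAntisymplectic_conj_iff`) this is the torus-level content of "the isomorphism type of
`((Y × Z)/graph(p), θ_p)` does not depend on `p`" as it is used in Def. 4: `𝒫_{g,δ}` is well defined on
isomorphism classes of level-structured pairs and invariant under `Sp(K(δ))`.
[cite: IribarLopez2024NoetherLefschetzCycles, §2.2 Lemma 10 (p. 7) and Def. 4 (p. 8)] [cite: Auffarth2016NonSimplePPAV, §3 Thm. 3.5 (pp. 9–10)] [cite: Lange2023AbelianVarietiesComplex, §1.1.2 (pp. 21–22) and §3.1.2 Prop. 3.1.4] -/
theorem exists_isPolarizedIso_quotientBy_graphSubgroup_conj :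
    ∃ (h : ComplexTorus (prodPeriod Φ₁ Φ₂) ≃+ ComplexTorus (prodPeriod Φ₁' Φ₂'))
      (k : ComplexTorus (quotientByPeriod (prodPeriod Φ₁ Φ₂) (graphSubgroup K₁ K₂ p)) ≃+
        ComplexTorus (quotientByPeriod (prodPeriod Φ₁' Φ₂')
          (graphSubgroup K₁' K₂' (e₂.toAddMonoidHom.comp (p.comp e₁.symm.toAddMonoidHom))))),
      IsPolarizedIso (prodPeriod Φ₁ Φ₂) (prodForm ω₁ ω₂) (prodPeriod Φ₁' Φ₂') (prodForm ω₁' ω₂') h ∧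
      (∀ t, prodHomeomorph Φ₁' Φ₂' (h t) = (h₁ (prodHomeomorph Φ₁ Φ₂ t).1, h₂ (prodHomeomorph Φ₁ Φ₂ t).2)) ∧
      IsPolarizedIso (quotientByPeriod (prodPeriod Φ₁ Φ₂) (graphSubgroup K₁ K₂ p)) (prodForm ω₁ ω₂)
        (quotientByPeriod (prodPeriod Φ₁' Φ₂')
          (graphSubgroup K₁' K₂' (e₂.toAddMonoidHom.comp (p.comp e₁.symm.toAddMonoidHom)))) (prodForm ω₁' ω₂')
        k ∧
      ∀ t, k (mapMatrix (prodPeriod Φ₁ Φ₂) (quotientByPeriod (prodPeriod Φ₁ Φ₂) (graphSubgroup K₁ K₂ p))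
          (quotientMatrix (prodPeriod Φ₁ Φ₂) (graphSubgroup K₁ K₂ p)) t) =
        mapMatrix (prodPeriod Φ₁' Φ₂') (quotientByPeriod (prodPeriod Φ₁' Φ₂')
          (graphSubgroup K₁' K₂' (e₂.toAddMonoidHom.comp (p.comp e₁.symm.toAddMonoidHom))))
          (quotientMatrix (prodPeriod Φ₁' Φ₂')
            (graphSubgroup K₁' K₂' (e₂.toAddMonoidHom.comp (p.comp e₁.symm.toAddMonoidHom)))) (h t) := by
  classical
  obtain ⟨h, hh, hc⟩ := exists_isPolarizedIso_prod_prodHomeomorph hh₁ hh₂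
  obtain ⟨k, hk, hkπ⟩ := hh.exists_isPolarizedIso_quotientBy (graphSubgroup K₁ K₂ p)
    (graphSubgroup K₁' K₂' (e₂.toAddMonoidHom.comp (p.comp e₁.symm.toAddMonoidHom)))
    (apply_mem_graphSubgroup_conj_iff he₁ he₂ hc p)
  exact ⟨h, k, hh, hc, hk, hkπ⟩

include hh₁ hh₂ he₁ he₂ in
/-- **The descended isomorphism respects the complementary pairs**: with `k ∘ π = π' ∘ (α × β)` as above,
`k(π(Y × 0)) = π'(Y' × 0)` and `k(π(0 × Z)) = π'(0 × Z')` (the images of the factors, A4-76 FILE B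
`subtorus_fstSubspace_map_graph` / `subtorus_sndSubspace_map_graph`) — "contains `(Y, θ_Y)`, `(Z, θ_Z)` as
complementary subvarieties", compatibly. [cite: IribarLopez2024NoetherLefschetzCycles, §2.2 Lemma 10 and Def. 4 ("parametrizes triplets `(X, Y, Z, θ)`")] [cite: Auffarth2016NonSimplePPAV, §3 Thm. 3.5] -/
theorem exists_isPolarizedIso_quotientBy_graphSubgroup_conj_map_subtorus :
    ∃ (h : ComplexTorus (prodPeriod Φ₁ Φ₂) ≃+ ComplexTorus (prodPeriod Φ₁' Φ₂'))
      (k : ComplexTorus (quotientByPeriod (prodPeriod Φ₁ Φ₂) (graphSubgroup K₁ K₂ p)) ≃+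
        ComplexTorus (quotientByPeriod (prodPeriod Φ₁' Φ₂')
          (graphSubgroup K₁' K₂' (e₂.toAddMonoidHom.comp (p.comp e₁.symm.toAddMonoidHom))))),
      IsPolarizedIso (prodPeriod Φ₁ Φ₂) (prodForm ω₁ ω₂) (prodPeriod Φ₁' Φ₂') (prodForm ω₁' ω₂') h ∧
      (∀ t, prodHomeomorph Φ₁' Φ₂' (h t) = (h₁ (prodHomeomorph Φ₁ Φ₂ t).1, h₂ (prodHomeomorph Φ₁ Φ₂ t).2)) ∧
      IsPolarizedIso (quotientByPeriod (prodPeriod Φ₁ Φ₂) (graphSubgroup K₁ K₂ p)) (prodForm ω₁ ω₂)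
        (quotientByPeriod (prodPeriod Φ₁' Φ₂')
          (graphSubgroup K₁' K₂' (e₂.toAddMonoidHom.comp (p.comp e₁.symm.toAddMonoidHom)))) (prodForm ω₁' ω₂')
        k ∧
      (∀ t, k (mapMatrix (prodPeriod Φ₁ Φ₂) (quotientByPeriod (prodPeriod Φ₁ Φ₂) (graphSubgroup K₁ K₂ p))
          (quotientMatrix (prodPeriod Φ₁ Φ₂) (graphSubgroup K₁ K₂ p)) t) =
        mapMatrix (prodPeriod Φ₁' Φ₂') (quotientByPeriod (prodPeriod Φ₁' Φ₂')
          (graphSubgroup K₁' K₂' (e₂.toAddMonoidHom.comp (p.comp e₁.symm.toAddMonoidHom))))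
          (quotientMatrix (prodPeriod Φ₁' Φ₂')
            (graphSubgroup K₁' K₂' (e₂.toAddMonoidHom.comp (p.comp e₁.symm.toAddMonoidHom)))) (h t)) ∧
      ((subtorus (prodPeriod Φ₁ Φ₂) (fstSubspace : Submodule ℝ (ι₁ ⊕ ι₂ → ℝ))).map
          (mapMatrixHom (prodPeriod Φ₁ Φ₂) (quotientByPeriod (prodPeriod Φ₁ Φ₂) (graphSubgroup K₁ K₂ p))
            (quotientMatrix (prodPeriod Φ₁ Φ₂) (graphSubgroup K₁ K₂ p)))).map k.toAddMonoidHom =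
        (subtorus (prodPeriod Φ₁' Φ₂') (fstSubspace : Submodule ℝ (ι₁' ⊕ ι₂' → ℝ))).map
          (mapMatrixHom (prodPeriod Φ₁' Φ₂') (quotientByPeriod (prodPeriod Φ₁' Φ₂')
            (graphSubgroup K₁' K₂' (e₂.toAddMonoidHom.comp (p.comp e₁.symm.toAddMonoidHom))))
            (quotientMatrix (prodPeriod Φ₁' Φ₂')
              (graphSubgroup K₁' K₂' (e₂.toAddMonoidHom.comp (p.comp e₁.symm.toAddMonoidHom))))) ∧
      ((subtorus (prodPeriod Φ₁ Φ₂) (sndSubspace : Submodule ℝ (ι₁ ⊕ ι₂ → ℝ))).map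
          (mapMatrixHom (prodPeriod Φ₁ Φ₂) (quotientByPeriod (prodPeriod Φ₁ Φ₂) (graphSubgroup K₁ K₂ p))
            (quotientMatrix (prodPeriod Φ₁ Φ₂) (graphSubgroup K₁ K₂ p)))).map k.toAddMonoidHom =
        (subtorus (prodPeriod Φ₁' Φ₂') (sndSubspace : Submodule ℝ (ι₁' ⊕ ι₂' → ℝ))).map
          (mapMatrixHom (prodPeriod Φ₁' Φ₂') (quotientByPeriod (prodPeriod Φ₁' Φ₂')
            (graphSubgroup K₁' K₂' (e₂.toAddMonoidHom.comp (p.comp e₁.symm.toAddMonoidHom))))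
            (quotientMatrix (prodPeriod Φ₁' Φ₂')
              (graphSubgroup K₁' K₂' (e₂.toAddMonoidHom.comp (p.comp e₁.symm.toAddMonoidHom))))) := by
  classical
  obtain ⟨h, k, hh, hc, hk, hkπ⟩ := exists_isPolarizedIso_quotientBy_graphSubgroup_conj hh₁ hh₂ he₁ he₂ p
  have hmap := map_map_eq_map_map_of_comp_eq
    (mapMatrixHom (prodPeriod Φ₁ Φ₂) (quotientByPeriod (prodPeriod Φ₁ Φ₂) (graphSubgroup K₁ K₂ p))
      (quotientMatrix (prodPeriod Φ₁ Φ₂) (graphSubgroup K₁ K₂ p)))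
    (mapMatrixHom (prodPeriod Φ₁' Φ₂') (quotientByPeriod (prodPeriod Φ₁' Φ₂')
      (graphSubgroup K₁' K₂' (e₂.toAddMonoidHom.comp (p.comp e₁.symm.toAddMonoidHom))))
      (quotientMatrix (prodPeriod Φ₁' Φ₂')
        (graphSubgroup K₁' K₂' (e₂.toAddMonoidHom.comp (p.comp e₁.symm.toAddMonoidHom))))) k hkπ
  refine ⟨h, k, hh, hc, hk, hkπ, ?_, ?_⟩
  · rw [hmap, map_subtorus_fstSubspace_eq hc]
  · rw [hmap, map_subtorus_sndSubspace_eq hc]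

end Main

/-! #### The case `Y' = Y`, `Z' = Z`: polarised automorphisms `α ∈ Aut(Y, θ_Y)`, `β ∈ Aut(Z, θ_Z)` -/

section Aut

variable {ι₁ ι₂ : Type*} [Fintype ι₁] [Fintype ι₂] [DecidableEq ι₁] [DecidableEq ι₂]
  {E₁ E₂ : Type*} [NormedAddCommGroup E₁] [NormedSpace ℂ E₁] [NormedAddCommGroup E₂] [NormedSpace ℂ E₂]
  {Φ₁ : (ι₁ → ℝ) ≃L[ℝ] E₁} {Φ₂ : (ι₂ → ℝ) ≃L[ℝ] E₂} {ω₁ : E₁ [⋀^Fin 2]→L[ℝ] ℝ} {ω₂ : E₂ [⋀^Fin 2]→L[ℝ] ℝ}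
  {G₁ : Matrix ι₁ ι₁ ℤ} {G₂ : Matrix ι₂ ι₂ ℤ}
  (hω₁ : IsRiemannForm Φ₁ ω₁) (hω₂ : IsRiemannForm Φ₂ ω₂)
  (hG₁ : G₁.map (Int.cast : ℤ → ℝ) = latticeGram Φ₁ ω₁) (hG₂ : G₂.map (Int.cast : ℤ → ℝ) = latticeGram Φ₂ ω₂)
  {α : ComplexTorus Φ₁ ≃+ ComplexTorus Φ₁} {β : ComplexTorus Φ₂ ≃+ ComplexTorus Φ₂}
  (hα : IsPolarizedIso Φ₁ ω₁ Φ₁ ω₁ α) (hβ : IsPolarizedIso Φ₂ ω₂ Φ₂ ω₂ β)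
  {p : kerPhiH Φ₁ G₁ →+ kerPhiH Φ₂ G₂} (hp : Bijective p) (ha : IsAntisymplectic ω₁ ω₂ p)

include hω₁ hω₂ hG₁ hG₂ hα hβ hp ha in
/-- **"The isomorphism type of `((Y × Z)/graph(p), θ_p)` does not depend on `p`" within an
`Aut(Z, θ_Z) × Aut(Y, θ_Y)`-orbit.**  For polarised tori `(Y, ω₁)`, `(Z, ω₂)` (Riemann forms, integer Gram
matrices `G₁`, `G₂`), an antisymplectic isomorphism `p : K(L₁) ≅ K(L₂)` and polarised automorphisms
`α ∈ Aut(Y, θ_Y)`, `β ∈ Aut(Z, θ_Z)`: the restrictions `α|_K`, `β|_K` exist, `β|_K ∘ p ∘ α|_K⁻¹` is again an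
antisymplectic isomorphism, both twisted products are PRINCIPALLY polarised by `ω₁ ⊞ ω₂` (A4-76), and `α × β`
descends to an isomorphism of principally polarised tori `((Y × Z)/graph(p), θ_p) ⥲ ((Y × Z)/graph(β p α⁻¹), θ)`
compatible with the projections.  (For fixed `(Y, θ_Y)`, `(Z, θ_Z)` and `p`, `p'` NOT so related the tori are in
general not isomorphic; the converse — isomorphic triples force `p' = β p α⁻¹` — is FILE I of the row.)
[cite: IribarLopez2024NoetherLefschetzCycles, §2.2 Lemma 10 ("does not depend on `p`") and Def. 4] [cite: Auffarth2016NonSimplePPAV, §3 Thm. 3.5 (proof: the `Sp(D)`-action permutes the fibers)] -/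
theorem exists_isPolarizedIso_quotientBy_graphSubgroup_of_polarized_automorphisms :
    ∃ (e₁ : kerPhiH Φ₁ G₁ ≃+ kerPhiH Φ₁ G₁) (e₂ : kerPhiH Φ₂ G₂ ≃+ kerPhiH Φ₂ G₂)
      (_ : ∀ s, (e₁ s : ComplexTorus Φ₁) = α s) (_ : ∀ s, (e₂ s : ComplexTorus Φ₂) = β s)
      (_ : Bijective (e₂.toAddMonoidHom.comp (p.comp e₁.symm.toAddMonoidHom)))
      (_ : IsAntisymplectic ω₁ ω₂ (e₂.toAddMonoidHom.comp (p.comp e₁.symm.toAddMonoidHom)))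
      (_ : Finite (graphSubgroup (kerPhiH Φ₁ G₁) (kerPhiH Φ₂ G₂) p))
      (_ : Finite (graphSubgroup (kerPhiH Φ₁ G₁) (kerPhiH Φ₂ G₂)
        (e₂.toAddMonoidHom.comp (p.comp e₁.symm.toAddMonoidHom))))
      (h : ComplexTorus (prodPeriod Φ₁ Φ₂) ≃+ ComplexTorus (prodPeriod Φ₁ Φ₂))
      (k : ComplexTorus (quotientByPeriod (prodPeriod Φ₁ Φ₂) (graphSubgroup (kerPhiH Φ₁ G₁) (kerPhiH Φ₂ G₂) p)) ≃+
        ComplexTorus (quotientByPeriod (prodPeriod Φ₁ Φ₂)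
          (graphSubgroup (kerPhiH Φ₁ G₁) (kerPhiH Φ₂ G₂) (e₂.toAddMonoidHom.comp (p.comp e₁.symm.toAddMonoidHom))))),
      IsPrincipalPolarization
          (quotientByPeriod (prodPeriod Φ₁ Φ₂) (graphSubgroup (kerPhiH Φ₁ G₁) (kerPhiH Φ₂ G₂) p)) (prodForm ω₁ ω₂) ∧
      IsPrincipalPolarization (quotientByPeriod (prodPeriod Φ₁ Φ₂)
          (graphSubgroup (kerPhiH Φ₁ G₁) (kerPhiH Φ₂ G₂) (e₂.toAddMonoidHom.comp (p.comp e₁.symm.toAddMonoidHom))))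
          (prodForm ω₁ ω₂) ∧
      IsPolarizedIso (prodPeriod Φ₁ Φ₂) (prodForm ω₁ ω₂) (prodPeriod Φ₁ Φ₂) (prodForm ω₁ ω₂) h ∧
      (∀ t, prodHomeomorph Φ₁ Φ₂ (h t) = (α (prodHomeomorph Φ₁ Φ₂ t).1, β (prodHomeomorph Φ₁ Φ₂ t).2)) ∧
      IsPolarizedIso (quotientByPeriod (prodPeriod Φ₁ Φ₂) (graphSubgroup (kerPhiH Φ₁ G₁) (kerPhiH Φ₂ G₂) p))
        (prodForm ω₁ ω₂)
        (quotientByPeriod (prodPeriod Φ₁ Φ₂)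
          (graphSubgroup (kerPhiH Φ₁ G₁) (kerPhiH Φ₂ G₂) (e₂.toAddMonoidHom.comp (p.comp e₁.symm.toAddMonoidHom))))
        (prodForm ω₁ ω₂) k ∧
      ∀ t, k (mapMatrix (prodPeriod Φ₁ Φ₂)
          (quotientByPeriod (prodPeriod Φ₁ Φ₂) (graphSubgroup (kerPhiH Φ₁ G₁) (kerPhiH Φ₂ G₂) p))
          (quotientMatrix (prodPeriod Φ₁ Φ₂) (graphSubgroup (kerPhiH Φ₁ G₁) (kerPhiH Φ₂ G₂) p)) t) =
        mapMatrix (prodPeriod Φ₁ Φ₂) (quotientByPeriod (prodPeriod Φ₁ Φ₂)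
          (graphSubgroup (kerPhiH Φ₁ G₁) (kerPhiH Φ₂ G₂) (e₂.toAddMonoidHom.comp (p.comp e₁.symm.toAddMonoidHom))))
          (quotientMatrix (prodPeriod Φ₁ Φ₂)
            (graphSubgroup (kerPhiH Φ₁ G₁) (kerPhiH Φ₂ G₂) (e₂.toAddMonoidHom.comp (p.comp e₁.symm.toAddMonoidHom))))
          (h t) := by
  obtain ⟨e₁, he₁⟩ := hα.exists_addEquiv_kerPhiH hG₁ hG₁
  obtain ⟨e₂, he₂⟩ := hβ.exists_addEquiv_kerPhiH hG₂ hG₂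
  have hp' : Bijective (e₂.toAddMonoidHom.comp (p.comp e₁.symm.toAddMonoidHom)) := (bijective_conj_iff p).2 hp
  have ha' : IsAntisymplectic ω₁ ω₂ (e₂.toAddMonoidHom.comp (p.comp e₁.symm.toAddMonoidHom)) :=
    (isAntisymplectic_conj_iff hG₁ hG₂ hG₁ hG₂ hα hβ he₁ he₂ p).2 ha
  haveI i1 : Finite (graphSubgroup (kerPhiH Φ₁ G₁) (kerPhiH Φ₂ G₂) p) := hω₁.finite_graphSubgroup hG₁ p
  haveI i2 : Finite (graphSubgroup (kerPhiH Φ₁ G₁) (kerPhiH Φ₂ G₂)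
      (e₂.toAddMonoidHom.comp (p.comp e₁.symm.toAddMonoidHom))) := hω₁.finite_graphSubgroup hG₁ _
  obtain ⟨h, k, hh, hc, hk, hkπ⟩ := exists_isPolarizedIso_quotientBy_graphSubgroup_conj hα hβ he₁ he₂ p
  exact ⟨e₁, e₂, he₁, he₂, hp', ha', i1, i2, h, k,
    isPrincipalPolarization_quotientBy_graphSubgroup hω₁ hω₂ hG₁ hG₂ hp ha,
    isPrincipalPolarization_quotientBy_graphSubgroup hω₁ hω₂ hG₁ hG₂ hp' ha', hh, hc, hk, hkπ⟩

end Aut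

end ComplexTorus

end Literature.Geometry.Kaehler

end
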